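/-
Copyright (c) 2026 the pub-hodgecm-mathlib formalisation cell (harness21).  Prover seat hodgecm-mathlib-K2E1-p02 (g2), Track B ∕ K2-LIT
(build stream 29), h413 = `stmt-HodgeConjecture-24833`, line `K2_E1_TraceFormulaBeta`, socket module «GlobalIndex» ED. 9∕10 — payer
programme of `sig_K2E1CuspCompactU2` :226, the (E) port, brick (B6: step domains of every level); dealer K2E1-plan (g0) standing queue 2026-09-03T23:50:06Z.
2026-09-04.
-/
import Summits.HodgeConjecture.HodgeConjecture.Theorems.K2E1SiegelRadicalChartU2Defs   -- K2E1-p02 (g2) ★ p855921: brings ★ `traceZeroAdele`, ★ `traceZeroFundamentalDomain`, ★ `smulTraceZero`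
import Literature.NumberTheory.Automorphic.GLnAdelicStructure                         -- ★ `integralFiniteAdeles`
import Literature.NumberTheory.Automorphic.GaloisActionAdeleRing                      -- ★ `FiniteAdeleRing.forall_smul_apply_mem_iff` (Galois preserves integrality)
import HarnessLib

/-!
# h413 ∕ Track B «K2-LIT», line `K2_E1_TraceFormulaBeta`, «GlobalIndex» — helper `K2E1SiegelStepDomainsU2` (brick (B6) of the (E) port for `U(Φ₂)`):
# step domains of every level: the scaled trace-zero Tate domains `2 c c̄ · 𝓕⁻ ⊂ 𝔸_L⁻`

Cell `pub/hodgecm-mathlib`, crux H413 = `stmt-HodgeConjecture-24833`, route of record `HCCMUnconditional`; chair K2-lead (g0), dealer K2E1-plan (g0)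
(standing queue 23:50:06Z; SPEC `K2/K2E1-p02/g2/SPEC-E-cone-U2.K2E1-p02-g2.md`).  Discharges the hypothesis `hdom` of brick B5 (★ p856177
`K2E1CuspSiegelEstimateCoreU2.exists_norm_orbitalSmoothing_le_of_domains`): for every level `c ∈ 𝓞 L`, `c ≠ 0`, a STEP DOMAIN `D ⊆ 𝔸_L⁻` — measurable, relatively
compact, of positive Haar measure, uniquely representing for the lattice `L⁻` (`∀ y, ∃! γ ∈ L⁻, γ + y ∈ D`), all of whose elements have finite part in `c · ∏_w 𝒪_w` — namely
`D = s · 𝓕⁻` with the `c`-fixed scalar `s = 2 c c̄ ∈ L⁺` (★ `smulTraceZero`; the `U(Φ₂)` replacement of ★ `scaledBlockFundamentalDomain`): `𝓕⁻ ⊆ ½(1 − c)(closure D_L)`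
(★ `traceZeroFundamentalDomain_subset_image`), points of `closure D_L` are finite-integral (the finite-integral adeles form an OPEN, hence closed, subgroup, ★
`isOpen_setOf_isFiniteIntegral`), the Galois conjugate of a finite-integral adele is finite-integral (★ `FiniteAdeleRing.forall_smul_apply_mem_iff`), and
`2 c c̄ · ½ (d − d̄) = c · (c̄ (d − d̄))`.  THEOREMS ONLY (no `def`, no `instance`, no `notation`, no named-fact hypothesis, no `sorry`); lane `--kind proof --supports
stmt-HodgeConjecture-24833 --as helper`.

* `isFiniteIntegral_mul`, `isFiniteIntegral_of_mem_closure_adeleFundamentalDomain`, `isFiniteIntegral_conjAdele` — integrality bookkeeping;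
* **`exists_stepDomain`** — the boxed existence statement, in the exact shape of `hdom`.

HONEST LABEL.  Count-neutral helper; closes no socket by itself; HC_CM is proved only modulo the 7 printed citations (2 remaining named inputs: hLiu418 =
`stmt-HodgeConjecture-24832`, h413 = `stmt-HodgeConjecture-24833`) until rung 0 closes.

## References
* [CasselsFrohlichANT1967] J. W. S. Cassels, A. Fröhlich (eds.), *Algebraic Number Theory* (1967), Ch. XV (Tate), Thm. 4.1.3, Cor. 4.1.1.
* [Garrett2018] P. Garrett, *Modern Analysis of Automorphic Forms by Example* (2018), Thm. 7.3.10 (PDF p. 340: the scaled domain and the level).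
-/

set_option autoImplicit false
-- the mandated namespace repeats `HodgeConjecture.HodgeConjecture`, as in every `Theorems/*.lean` of this sub-problem
set_option linter.dupNamespace false

noncomputable section

open NumberField IsDedekindDomain MeasureTheory Measure Filter Topology Set
open scoped NNReal Pointwise ENNReal

namespace Summit.HodgeConjecture.HodgeConjecture.Cruxes.H413.K2E1SiegelStepDomainsU2

open Literature.NumberTheory.Automorphic Literature.NumberTheory.Automorphic.UnitaryGroup

variable (L : Type) [Field L] [NumberField L] [IsCMField L]

/-! ## §1 Integrality bookkeeping -/

omit [IsCMField L] in
/-- Finite-integral adeles are closed under multiplication. [cite: CasselsFrohlichANT1967, Ch. XV Lemma 4.1.3] -/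
theorem isFiniteIntegral_mul {x y : AdeleRing (𝓞 L) L} (hx : IsFiniteIntegral L x) (hy : IsFiniteIntegral L y) : IsFiniteIntegral L (x * y) :=
  fun v => by
    change x.2 v * y.2 v ∈ _
    exact mul_mem (hx v) (hy v)

omit [IsCMField L] in
/-- **Points of the closure of Tate's domain are finite-integral**: the finite-integral adeles `L_∞ × ∏_w 𝒪_w` form an open (★ `isOpen_setOf_isFiniteIntegral`), hence
closed, additive subgroup containing `D_L`. [cite: CasselsFrohlichANT1967, Ch. XV Cor. 4.1.1] -/
theorem isFiniteIntegral_of_mem_closure_adeleFundamentalDomain {d : AdeleRing (𝓞 L) L} (hd : d ∈ closure (adeleFundamentalDomain L)) :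
    IsFiniteIntegral L d := by
  let S : AddSubgroup (AdeleRing (𝓞 L) L) :=
    { carrier := {x | IsFiniteIntegral L x}
      zero_mem' := isFiniteIntegral_zero L
      add_mem' := fun hx hy => IsFiniteIntegral.add _ hx hy
      neg_mem' := fun hx => IsFiniteIntegral.neg _ hx }
  have hcl : IsClosed (S : Set (AdeleRing (𝓞 L) L)) := S.isClosed_of_isOpen (isOpen_setOf_isFiniteIntegral L)
  have hsub : adeleFundamentalDomain L ⊆ (S : Set (AdeleRing (𝓞 L) L)) := fun x hx => hx.1
  exact closure_minimal hsub hcl hd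

/-- **The Galois conjugate of a finite-integral adele is finite-integral** (★ `FiniteAdeleRing.forall_smul_apply_mem_iff`). [folklore] -/
theorem isFiniteIntegral_conjAdele {d : AdeleRing (𝓞 L) L} (hd : IsFiniteIntegral L d) :
    IsFiniteIntegral L (conjAdele (↥(maximalRealSubfield L)) L (IsCMField.complexConj L) d) := by
  intro v
  rw [conjAdele_apply, AdeleRing.smul_snd]
  exact (FiniteAdeleRing.forall_smul_apply_mem_iff L (IsCMField.complexConj L) d.2).2 hd v

/-! ## §2 Step domains of every level -/

/-- **STEP DOMAINS OF EVERY LEVEL.**  For `c ∈ 𝓞 L`, `c ≠ 0`, and an additive Haar measure `ν⁻` on `𝔸_L⁻`, there are `D ⊆ K_D ⊆ 𝔸_L⁻` with `D` measurable, `K_D` compact, `ν⁻ D ≠ 0`,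
`∀ y, ∃! γ ∈ L⁻, γ + y ∈ D`, and every `X ∈ D` having finite part `c · y` with `y ∈ ∏_w 𝒪_w` — the hypothesis `hdom` of ★ `exists_norm_orbitalSmoothing_le_of_domains`.  Take
`D = s · 𝓕⁻`, `s = 2 c c̄` (★ `smulTraceZero` by the principal `c`-fixed idele `s`): measurability and relative compactness transport along the homeomorphism, unique
representability transports because `s L⁻ = L⁻`, positivity follows from unique representability (Mathlib `IsAddFundamentalDomain.measure_ne_zero`), and for
`X = s · ½(d − d̄)`, `d ∈ closure D_L`: `X_f = c · (c̄ (d − d̄))_f` with `c̄ (d − d̄)` finite-integral (§1). [cite: CasselsFrohlichANT1967, Ch. XV Thm. 4.1.3]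
[cite: Garrett2018, Thm. 7.3.10 (PDF p. 340)] -/
theorem exists_stepDomain (c : 𝓞 L) (hc0 : c ≠ 0) [MeasurableSpace (AdeleRing (𝓞 L) L)] [BorelSpace (AdeleRing (𝓞 L) L)]
    (νV : Measure ↥(traceZeroAdele (↥(maximalRealSubfield L)) L (IsCMField.complexConj L))) [νV.IsAddHaarMeasure] :
    ∃ D KD : Set ↥(traceZeroAdele (↥(maximalRealSubfield L)) L (IsCMField.complexConj L)),
      MeasurableSet D ∧ IsCompact KD ∧ D ⊆ KD ∧ νV D ≠ 0 ∧
      (∀ y : ↥(traceZeroAdele (↥(maximalRealSubfield L)) L (IsCMField.complexConj L)),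
        ∃! γ : ↥(rationalTraceZero (↥(maximalRealSubfield L)) L (IsCMField.complexConj L)), γ +ᵥ y ∈ D) ∧
      (∀ X ∈ D, ∃ y ∈ integralFiniteAdeles L,
        ((X : ↥(traceZeroAdele (↥(maximalRealSubfield L)) L (IsCMField.complexConj L))) : AdeleRing (𝓞 L) L).2 =
          algebraMap (𝓞 L) (FiniteAdeleRing (𝓞 L) L) c * y) := by
  -- `c² = 1` for the CM conjugation
  have hc2 : IsCMField.complexConj L * IsCMField.complexConj L = 1 := by
    ext y
    exact IsCMField.complexConj_apply_apply L y
  -- the scalar `s = 2 c c̄ ∈ L⁺`, a nonzero `c`-fixed element of `L`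
  set cL : L := (c : L) with hcL
  have hcL0 : cL ≠ 0 := RingOfIntegers.coe_ne_zero_iff.mpr hc0
  set s : L := 2 * (cL * IsCMField.complexConj L cL) with hs
  have hs0 : s ≠ 0 := mul_ne_zero two_ne_zero (mul_ne_zero hcL0 ((map_ne_zero _).2 hcL0))
  have hsfix : IsCMField.complexConj L s = s := by
    rw [hs, map_mul, map_mul, map_ofNat, IsCMField.complexConj_apply_apply, mul_comm (IsCMField.complexConj L cL) cL]
  -- the principal idele `s` and the scaling `e : y ↦ s y` of `𝔸_L⁻`
  set l : (AdeleRing (𝓞 L) L)ˣ := Units.map (algebraMap L (AdeleRing (𝓞 L) L) : L →* AdeleRing (𝓞 L) L) (Units.mk0 s hs0) with hl_def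
  have hlval : (l : AdeleRing (𝓞 L) L) = algebraMap L (AdeleRing (𝓞 L) L) s := rfl
  have hlinv : ((l⁻¹ : (AdeleRing (𝓞 L) L)ˣ) : AdeleRing (𝓞 L) L) = algebraMap L (AdeleRing (𝓞 L) L) s⁻¹ := rfl
  have hl : conjAdele (↥(maximalRealSubfield L)) L (IsCMField.complexConj L) (l : AdeleRing (𝓞 L) L) = l := by
    rw [hlval, ← algebraMap_conj, RingHom.coe_coe, hsfix]
  set e := smulTraceZero l hl with he_def
  have he_coe : ∀ y : ↥(traceZeroAdele (↥(maximalRealSubfield L)) L (IsCMField.complexConj L)),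
      ((e y : ↥(traceZeroAdele (↥(maximalRealSubfield L)) L (IsCMField.complexConj L))) : AdeleRing (𝓞 L) L) =
        algebraMap L (AdeleRing (𝓞 L) L) s * (y : AdeleRing (𝓞 L) L) := fun y => coe_smulTraceZero l hl y
  have he_symm_coe : ∀ y : ↥(traceZeroAdele (↥(maximalRealSubfield L)) L (IsCMField.complexConj L)),
      ((e.symm y : ↥(traceZeroAdele (↥(maximalRealSubfield L)) L (IsCMField.complexConj L))) : AdeleRing (𝓞 L) L) =
        algebraMap L (AdeleRing (𝓞 L) L) s⁻¹ * (y : AdeleRing (𝓞 L) L) := by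
    intro y
    have h := congrArg (fun z : ↥(traceZeroAdele (↥(maximalRealSubfield L)) L (IsCMField.complexConj L)) => (z : AdeleRing (𝓞 L) L))
      (e.apply_symm_apply y)
    simp only [he_coe] at h
    -- `s * e⁻¹ y = y`
    rw [← h, ← mul_assoc, ← map_mul, inv_mul_cancel₀ hs0, map_one, one_mul]
  -- rational elements are carried to rational elements (both ways): `s L⁻ = L⁻`
  have hrat : ∀ g : ↥(rationalTraceZero (↥(maximalRealSubfield L)) L (IsCMField.complexConj L)),
      e (g : ↥(traceZeroAdele (↥(maximalRealSubfield L)) L (IsCMField.complexConj L))) ∈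
        rationalTraceZero (↥(maximalRealSubfield L)) L (IsCMField.complexConj L) := by
    intro g
    obtain ⟨ξ, hξ⟩ := (mem_rationalTraceZero_iff _).1 g.2
    refine (mem_rationalTraceZero_iff _).2 ⟨s * ξ, ?_⟩
    rw [he_coe, map_mul, hξ]
  have hrat' : ∀ γ : ↥(rationalTraceZero (↥(maximalRealSubfield L)) L (IsCMField.complexConj L)),
      e.symm (γ : ↥(traceZeroAdele (↥(maximalRealSubfield L)) L (IsCMField.complexConj L))) ∈
        rationalTraceZero (↥(maximalRealSubfield L)) L (IsCMField.complexConj L) := by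
    intro γ
    obtain ⟨ξ, hξ⟩ := (mem_rationalTraceZero_iff _).1 γ.2
    refine (mem_rationalTraceZero_iff _).2 ⟨s⁻¹ * ξ, ?_⟩
    rw [he_symm_coe, map_mul, hξ]
  -- the domain `D = s 𝓕⁻` and its compact superset
  set D : Set ↥(traceZeroAdele (↥(maximalRealSubfield L)) L (IsCMField.complexConj L)) :=
    e '' traceZeroFundamentalDomain (↥(maximalRealSubfield L)) L (IsCMField.complexConj L) with hD
  obtain ⟨K, hK, hsub⟩ := exists_isCompact_traceZeroFundamentalDomain_subset (F := ↥(maximalRealSubfield L)) (E := L) (c := IsCMField.complexConj L) hc2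
  have hDm : MeasurableSet D := e.toHomeomorph.measurableEmbedding.measurableSet_image.2 measurableSet_traceZeroFundamentalDomain
  -- unique representability transports along `e`
  have huniq : ∀ y : ↥(traceZeroAdele (↥(maximalRealSubfield L)) L (IsCMField.complexConj L)),
      ∃! γ : ↥(rationalTraceZero (↥(maximalRealSubfield L)) L (IsCMField.complexConj L)), γ +ᵥ y ∈ D := by
    intro y
    obtain ⟨g, hg, hgu⟩ := existsUnique_vadd_mem_traceZeroFundamentalDomain hc2 (e.symm y)
    refine ⟨⟨e (g : ↥(traceZeroAdele (↥(maximalRealSubfield L)) L (IsCMField.complexConj L))), hrat g⟩, ?_, ?_⟩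
    · -- `e g + y = e (g + e⁻¹ y) ∈ e 𝓕⁻`
      change e (g : ↥(traceZeroAdele (↥(maximalRealSubfield L)) L (IsCMField.complexConj L))) + y ∈ D
      refine ⟨(g : ↥(traceZeroAdele (↥(maximalRealSubfield L)) L (IsCMField.complexConj L))) + e.symm y, hg, ?_⟩
      rw [map_add, e.apply_symm_apply]
    · intro γ hγ
      obtain ⟨z, hz, hze⟩ := hγ
      -- `z = e⁻¹ γ + e⁻¹ y`, so `e⁻¹ γ` is the unique lattice translate
      have hz' : z = e.symm (γ : ↥(traceZeroAdele (↥(maximalRealSubfield L)) L (IsCMField.complexConj L))) + e.symm y := by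
        have h := congrArg e.symm hze
        rw [e.symm_apply_apply] at h
        rw [h, AddSubgroup.vadd_def, vadd_eq_add, map_add]
      have hmem : (⟨e.symm (γ : ↥(traceZeroAdele (↥(maximalRealSubfield L)) L (IsCMField.complexConj L))), hrat' γ⟩ :
          ↥(rationalTraceZero (↥(maximalRealSubfield L)) L (IsCMField.complexConj L))) +ᵥ e.symm y ∈
          traceZeroFundamentalDomain (↥(maximalRealSubfield L)) L (IsCMField.complexConj L) := by
        rw [AddSubgroup.vadd_def, vadd_eq_add]
        change e.symm (γ : ↥(traceZeroAdele (↥(maximalRealSubfield L)) L (IsCMField.complexConj L))) + e.symm y ∈ _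
        rw [← hz']
        exact hz
      have hγg := hgu _ hmem
      apply Subtype.ext
      change (γ : ↥(traceZeroAdele (↥(maximalRealSubfield L)) L (IsCMField.complexConj L))) =
        e (g : ↥(traceZeroAdele (↥(maximalRealSubfield L)) L (IsCMField.complexConj L)))
      rw [← hγg]
      exact (e.apply_symm_apply _).symm
  -- positivity of the measure of `D`
  haveI : Countable ↥(rationalTraceZero (↥(maximalRealSubfield L)) L (IsCMField.complexConj L)) := countable_rationalTraceZero
  have hν0 : νV ≠ 0 := fun h => isOpen_univ.measure_ne_zero νV univ_nonempty (by rw [h]; rfl)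
  have hD0 : νV D ≠ 0 := (IsAddFundamentalDomain.mk' hDm.nullMeasurableSet huniq).measure_ne_zero hν0
  refine ⟨D, e '' K, hDm, hK.image e.continuous, Set.image_mono hsub, hD0, huniq, ?_⟩
  -- the level: finite parts of the points of `D`
  rintro X ⟨x', hx', rfl⟩
  obtain ⟨d, hd, hdx'⟩ := traceZeroFundamentalDomain_subset_image hc2 hx'
  have hdint : IsFiniteIntegral L d := isFiniteIntegral_of_mem_closure_adeleFundamentalDomain L hd
  have hcdint : IsFiniteIntegral L (conjAdele (↥(maximalRealSubfield L)) L (IsCMField.complexConj L) d) := isFiniteIntegral_conjAdele L hdint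
  have hcLint : IsFiniteIntegral L (algebraMap L (AdeleRing (𝓞 L) L) cL) := (isFiniteIntegral_algebraMap_iff L cL).2 ⟨c, rfl⟩
  have hccLint : IsFiniteIntegral L (algebraMap L (AdeleRing (𝓞 L) L) (IsCMField.complexConj L cL)) := by
    have h : algebraMap L (AdeleRing (𝓞 L) L) (IsCMField.complexConj L cL) =
        conjAdele (↥(maximalRealSubfield L)) L (IsCMField.complexConj L) (algebraMap L (AdeleRing (𝓞 L) L) cL) := by
      rw [← algebraMap_conj, RingHom.coe_coe]
    rw [h]
    exact isFiniteIntegral_conjAdele L hcLint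
  set W : AdeleRing (𝓞 L) L := algebraMap L (AdeleRing (𝓞 L) L) (IsCMField.complexConj L cL) *
    (d - conjAdele (↥(maximalRealSubfield L)) L (IsCMField.complexConj L) d) with hW
  have hWint : IsFiniteIntegral L W := isFiniteIntegral_mul L hccLint (IsFiniteIntegral.sub _ hdint hcdint)
  refine ⟨W.2, fun v => hWint v, ?_⟩
  -- `s · ½(d − d̄) = c · (c̄ (d − d̄))` in `𝔸_L`
  have hX : ((e x' : ↥(traceZeroAdele (↥(maximalRealSubfield L)) L (IsCMField.complexConj L))) : AdeleRing (𝓞 L) L) =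
      algebraMap L (AdeleRing (𝓞 L) L) cL * W := by
    rw [he_coe, ← hdx', coe_adeleMinus, hW, halfAdele, ← mul_assoc, ← map_mul, ← mul_assoc, ← map_mul, hs]
    congr 2
    field_simp
  have h2 : ∀ z w : AdeleRing (𝓞 L) L, (z * w).2 = z.2 * w.2 := fun z w => rfl
  have halg : (algebraMap L (AdeleRing (𝓞 L) L) cL).2 = algebraMap (𝓞 L) (FiniteAdeleRing (𝓞 L) L) c := by
    rw [IsScalarTower.algebraMap_apply (𝓞 L) L (FiniteAdeleRing (𝓞 L) L)]
    rfl
  rw [hX, h2, halg]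

end Summit.HodgeConjecture.HodgeConjecture.Cruxes.H413.K2E1SiegelStepDomainsU2

end
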